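import Mathlib.Analysis.SpecialFunctions.Log.ENNRealLogExp
import Mathlib.Analysis.SpecialFunctions.Pow.Continuity
import Literature.MathematicalPhysics.QuantumFieldTheory.QCDOS
import HarnessLib

/-!
# Box mixing of lattice QCD at a physical scale, its continuum profile, the step variable `z`
# and the step relation `σ` (Lüscher–Weisz–Wolff-type step scaling in mixing language)

Objects posited by route `FemtoStepScaling` of `Summits/QuantumFields/QCD` (definition request D3,
work item `defn-boxMixingStepScaling`), inlined verbatim by its items `BoxMixingDecay` and
`PhysicalFiniteSizeCriterion`; all over the tree's honest lattice-QCD torus functional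
`qcdTorusExpect` (Wilson action, `N_f` Berezin-integrated Wilson quarks, signed determinant) along a
regularisation `reg : QCDRegularisation N_f` at renormalised masses `m` (bare masses
`(reg.scheme m 0 0).mq · k = m_crit(k) + a_k m_f / Z_m(k)`).

* `gluonicCov Ex A B v` — connected covariance `Ex(A · τ_v B) − Ex(A) Ex(τ_v B)` of two bounded
  gauge-invariant gluonic cylinder observables `A, B : YMSpecies G` (real scalars embedded in the
  Grassmann algebra by `algebraMap`), `B` translated by `v ∈ ℤ⁴`, under a functional `Ex`.
* `mixingCoeff Ex 𝒜 ℬ v : ℝ≥0∞` — `sup_{A ∈ 𝒜, B ∈ ℬ} ‖gluonicCov Ex A B v‖`, the mixing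
  coefficient of `Ex` between two observable classes at displacement `v` (Euclidean-time analogue
  of a ρ-mixing coefficient); monotone in the classes (`mixingCoeff_mono`).
* `slabClass a ℓ` — the route's class: `sup |A| ≤ 1`, every support edge has base point with time
  coordinate `x₀` in the slab `0 ≤ x₀`, `8 x₀ a ≤ ℓ` (physical thickness `ℓ/8`).
* `boxMixing reg m k ℓ : ℝ≥0∞` — request (1): on the hypercubic torus of side `2S+1`,
  `S = ⌊ℓ/(2a_k)⌋₊` (`QCDRegularisation.boxHalfSide`), the mixing coefficient of `qcdTorusExpect` at
  `(β_k, m_f(k))` between two copies of `slabClass (a_k) ℓ` at the time shift `S e₀` (half the box);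
  `forall_slab_le_iff_boxMixing_le` identifies `boxMixing reg m k ℓ ≤ ENNReal.ofReal ε` with the
  route's inlined `∀ S, S = … → ∀ Ex, Ex = … → ∀ ι, ι = … → ∀ InSlab, InSlab = … → …` clause.
* `boxMixingProfile reg m ℓ : ℝ≥0∞ := limsup_k boxMixing reg m k ℓ` — request (2), `ε(ℓ)`.
* `zOfMixing ε : EReal := log ((2/ε)^{8/3}) = −(8/3) log(ε/2)`, `boxMixingZ reg m ℓ := zOfMixing ε(ℓ)`
  — request (3), the Lüscher–Weisz–Wolff-type variable (`ε = 2e^{−3z/8}`: by the transfer matrix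
  the slab covariance across half the periodic box is `≈ 2 e^{−3 m(ℓ)ℓ/8}`, so `z` is the route's
  proxy for the finite-volume gap variable `z = m(ℓ) ℓ` of Koller–van Baal / Lüscher–Weisz–Wolff).
* `stepRelation reg m : Set (ℝ × ℝ)` — request (3), `σ := closure {(z(ℓ), z(2ℓ)) : ℓ > 0, finite}`,
  the set-valued step-scaling function of one real variable (as the continuum step scaling
  function `σ(ḡ²(L)) = ḡ²(2L)` of the recursive finite-size technique, Weisz (2.154)–(2.157),
  Del Debbio–Ramos §6.7.2, for the variable `z` instead of a coupling; a function where limits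
  are unique).

**Design choices (documented junk values).** `boxMixing`, its profile (`ℝ≥0∞`) and `z` (`EReal`)
need no side conditions: `boxMixing = ⊤` iff the slab covariances are unbounded (excluded when the
twisted partition function is non-zero, the fermion weight being a bounded continuous function of
the links — not proved here); `z = ⊤` iff `ε = 0`, `z = ⊥` iff `ε = ⊤`, and on `0 < ε < ∞` it is the
printed formula (`zOfMixing_ofReal`, `zOfMixing_two_mul_exp`). "`z(ℓ) → ∞ ⟺ ε(ℓ) → 0`" is
`tendsto_boxMixingZ_nhds_top_iff`, along any filter of scales. `stepRelation` keeps the finite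
pairs, in `ℝ × ℝ` as requested.

**Sources.** Step scaling / recursive finite-size technique: Lüscher–Weisz–Wolff, Nucl. Phys.
B 359 (1991) 221 (running coupling from the finite-volume gap); Lüscher–Sommer–Weisz–Wolff,
Nucl. Phys. B 413 (1994) 481 (SU(3)); P. Weisz, Les Houches 2009, §2.3.2 (2.154)–(2.157)
(`ḡ²(2L) = σ(ḡ²(L))` in the continuum, `Σ(u, a/L)` on the lattice, `σ(u) = u + 2b₀ ln 2 · u² + …`);
Del Debbio–Ramos, Phys. Rep. 2021, §6.7.2 (`lim_{a→0} Σ_s(u, a/L) = σ_s(u)`). The variable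
`z = M L`: Koller–van Baal, Nucl. Phys. B 273 (1986) 387, abstract and (29). Transfer matrix /
clustering: Lüscher, CMP 54 (1977) 283; Osterwalder–Seiler 1978 §§2–4. NOT here: any claim about
the QCD values of these objects (the route's items), the anisotropic / twisted functionals
(requests D1, D2), finiteness of `boxMixing`.
-/

open MeasureTheory Filter
open scoped ENNReal NNReal Topology
open Literature.Probability.LatticeModels Literature.MathematicalPhysics.QuantumLattice

noncomputable section

namespace Literature.MathematicalPhysics.QuantumFieldTheory

/-! ### Connected covariances of gluonic observables and mixing coefficients -/

section Generic

variable {G : Type} [Group G] [MeasurableSpace G] {𝔄 : Type*} [Ring 𝔄] [Algebra ℂ 𝔄] {N : ℕ}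

/-- **Connected covariance of two gluonic observables under a functional `Ex`.** For bounded
gauge-invariant cylinder observables `A, B : YMSpecies G` of the `ℤ⁴` gauge field, a torus side `N`,
a displacement `v ∈ ℤ⁴` and a functional `Ex` on `𝔄`-valued functions of the torus gauge field
(`𝔄` a `ℂ`-algebra — for lattice QCD the quark Grassmann algebra `FermiAlg N_f N` and
`Ex = qcdTorusExpect β N m`): `Ex(A · τ_v B) − Ex(A) · Ex(τ_v B)`, where `A` is read on the periodic
lift `torusLift N U`, `τ_v B` is `B ∘ configShift (−v)` (the observable `B` AT `v`), and real values
are embedded as scalars by `algebraMap ℂ 𝔄`. This is the expression the route `FemtoStepScaling`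
inlines (with `ι = fun r : ℝ => algebraMap ℂ _ (r : ℂ)`). [cite: OsterwalderSeiler1978, §§2–4 (clustering of gauge-invariant time-translated observables)] -/
def gluonicCov (Ex : (GaugeConfig 4 N G → 𝔄) → ℂ) (A B : YMSpecies G)
    (v : _root_.Literature.Probability.LatticeModels.Site 4) : ℂ :=
  Ex (fun U => algebraMap ℂ 𝔄 ((A.F (torusLift N U) : ℝ) : ℂ) *
      algebraMap ℂ 𝔄 ((B.F (configShift (-v) (torusLift N U)) : ℝ) : ℂ)) -
    Ex (fun U => algebraMap ℂ 𝔄 ((A.F (torusLift N U) : ℝ) : ℂ)) *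
      Ex (fun U => algebraMap ℂ 𝔄 ((B.F (configShift (-v) (torusLift N U)) : ℝ) : ℂ))

/-- **Mixing coefficient of `Ex` between two classes of gluonic observables at displacement `v`:**
`sup {‖Ex(A · τ_v B) − Ex(A) Ex(τ_v B)‖ : A ∈ 𝒜, B ∈ ℬ}`, valued in `ℝ≥0∞` (no boundedness side
condition; `0` for empty classes). With `𝒜 = ℬ =` the unit ball of observables measurable in a
time slab and `v` a time translation this is the (un-normalised) ρ-mixing profile of the
Euclidean-time "process", governed by the transfer-matrix gap. [folklore] -/
def mixingCoeff (Ex : (GaugeConfig 4 N G → 𝔄) → ℂ) (𝒜 ℬ : Set (YMSpecies G))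
    (v : _root_.Literature.Probability.LatticeModels.Site 4) : ℝ≥0∞ :=
  ⨆ A ∈ 𝒜, ⨆ B ∈ ℬ, ‖gluonicCov Ex A B v‖ₑ

variable (Ex : (GaugeConfig 4 N G → 𝔄) → ℂ)

/-- Every covariance in the classes is below the mixing coefficient. [folklore] -/
theorem enorm_gluonicCov_le_mixingCoeff {𝒜 ℬ : Set (YMSpecies G)} {A B : YMSpecies G}
    (hA : A ∈ 𝒜) (hB : B ∈ ℬ) (v : _root_.Literature.Probability.LatticeModels.Site 4) :
    ‖gluonicCov Ex A B v‖ₑ ≤ mixingCoeff Ex 𝒜 ℬ v :=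
  (le_iSup₂ (f := fun B (_ : B ∈ ℬ) => ‖gluonicCov Ex A B v‖ₑ) B hB).trans
    (le_iSup₂ (f := fun A (_ : A ∈ 𝒜) => ⨆ B ∈ ℬ, ‖gluonicCov Ex A B v‖ₑ) A hA)

/-- `mixingCoeff ≤ c` unfolded: every covariance in the classes has (extended) norm `≤ c`.
[folklore] -/
theorem mixingCoeff_le_iff {𝒜 ℬ : Set (YMSpecies G)}
    {v : _root_.Literature.Probability.LatticeModels.Site 4} {c : ℝ≥0∞} :
    mixingCoeff Ex 𝒜 ℬ v ≤ c ↔ ∀ A ∈ 𝒜, ∀ B ∈ ℬ, ‖gluonicCov Ex A B v‖ₑ ≤ c := by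
  simp only [mixingCoeff, iSup_le_iff]

/-- `mixingCoeff ≤ ε` for a real `ε ≥ 0`, in terms of the ordinary norm. [folklore] -/
theorem mixingCoeff_le_ofReal_iff {𝒜 ℬ : Set (YMSpecies G)}
    {v : _root_.Literature.Probability.LatticeModels.Site 4} {ε : ℝ} (hε : 0 ≤ ε) :
    mixingCoeff Ex 𝒜 ℬ v ≤ ENNReal.ofReal ε ↔ ∀ A ∈ 𝒜, ∀ B ∈ ℬ, ‖gluonicCov Ex A B v‖ ≤ ε := by
  simp only [mixingCoeff_le_iff, ← ofReal_norm, ENNReal.ofReal_le_ofReal_iff hε]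

/-- **Monotonicity of the mixing coefficient in the observable classes**: enlarging either class
can only increase it. [folklore] -/
theorem mixingCoeff_mono {𝒜 𝒜' ℬ ℬ' : Set (YMSpecies G)} (h𝒜 : 𝒜 ⊆ 𝒜') (hℬ : ℬ ⊆ ℬ')
    (v : _root_.Literature.Probability.LatticeModels.Site 4) :
    mixingCoeff Ex 𝒜 ℬ v ≤ mixingCoeff Ex 𝒜' ℬ' v :=
  (mixingCoeff_le_iff Ex).2 fun _ hA _ hB => enorm_gluonicCov_le_mixingCoeff Ex (h𝒜 hA) (hℬ hB) v

end Generic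

/-! ### The slab class and the box mixing of lattice QCD at a physical scale -/

section QCD

local notation "𝔾" => Matrix.specialUnitaryGroup (Fin 3) ℂ

variable {G : Type} [Group G] [MeasurableSpace G]

/-- **The slab class at lattice spacing `a` and physical scale `ℓ`**: bounded (`sup |A| ≤ 1`)
gauge-invariant gluonic cylinder observables all of whose support edges have base point `x` with
Euclidean-time coordinate in the slab `0 ≤ x₀` and `8 x₀ a ≤ ℓ` (thickness `ℓ/8` in physical units;
literally the predicate `InSlab` inlined by route `FemtoStepScaling`). [folklore] -/
def slabClass (a ℓ : ℝ) : Set (YMSpecies G) :=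
  {A | (∀ U, |A.F U| ≤ 1) ∧ ∀ e ∈ A.supp, (0 : ℤ) ≤ e.1 0 ∧ (8 : ℝ) * ((e.1 0 : ℤ) : ℝ) * a ≤ ℓ}

/-- The slab class grows with the scale `ℓ` (at fixed spacing). [folklore] -/
theorem slabClass_mono (a : ℝ) {ℓ ℓ' : ℝ} (h : ℓ ≤ ℓ') :
    (slabClass a ℓ : Set (YMSpecies G)) ⊆ slabClass a ℓ' :=
  fun _ hA => ⟨hA.1, fun e he => ⟨(hA.2 e he).1, (hA.2 e he).2.trans h⟩⟩

/-- The slab class shrinks as the spacing grows (at fixed scale): for `a ≤ a'`,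
`slabClass a' ℓ ⊆ slabClass a ℓ` (time coordinates in the slab are non-negative). [folklore] -/
theorem slabClass_anti {a a' : ℝ} (ha' : a ≤ a') (ℓ : ℝ) :
    (slabClass a' ℓ : Set (YMSpecies G)) ⊆ slabClass a ℓ := by
  rintro A ⟨hb, hs⟩
  refine ⟨hb, fun e he => ⟨(hs e he).1, le_trans ?_ (hs e he).2⟩⟩
  have h0 : (0 : ℝ) ≤ 8 * ((e.1 0 : ℤ) : ℝ) := by
    have : (0 : ℝ) ≤ ((e.1 0 : ℤ) : ℝ) := by exact_mod_cast (hs e he).1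
    positivity
  exact mul_le_mul_of_nonneg_left ha' h0

variable {Nf : ℕ}

/-- **Half-side of the `ℓ`-box in lattice units** at step `k` of the regularisation:
`S = ⌊ℓ/(2a_k)⌋₊`, so that the hypercubic torus of side `2S+1` has physical side `≈ ℓ`. [folklore] -/
def QCDRegularisation.boxHalfSide (reg : QCDRegularisation Nf) (k : ℕ) (ℓ : ℝ) : ℕ :=
  ⌊ℓ / (2 * reg.a k)⌋₊

/-- **Box mixing of lattice QCD at physical scale `ℓ`, step `k`, masses `m`** (route
`FemtoStepScaling`, request D3 (1)): on the hypercubic torus of side `2S+1`, `S = ⌊ℓ/(2a_k)⌋₊`, at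
inverse coupling `β_k` and bare masses `m_f(k) = m_crit(k) + a_k m_f/Z_m(k)`, the supremum over pairs
`A, B` in the slab class `slabClass (a_k) ℓ` (sup `≤ 1`, supported in the time slab `[0, ℓ/(8a_k)]`)
of `‖⟨A · τ_{S e₀} B⟩ − ⟨A⟩⟨τ_{S e₀} B⟩‖` under `qcdTorusExpect` — the time-direction mixing
coefficient across half the box. Heuristically (transfer matrix, gap `m(ℓ)` of the `ℓ³`-torus
Hamiltonian, both time directions around the periodic torus) `≈ 2 e^{−3 m(ℓ) ℓ/8}`. Valued in
`ℝ≥0∞` (see the module docstring). [folklore] -/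
def boxMixing (reg : QCDRegularisation Nf) (m : Fin Nf → ℝ) (k : ℕ) (ℓ : ℝ) : ℝ≥0∞ :=
  mixingCoeff
    (qcdTorusExpect (reg.β k) (2 * reg.boxHalfSide k ℓ + 1) (fun fl => (reg.scheme m 0 0).mq fl k))
    (slabClass (reg.a k) ℓ) (slabClass (reg.a k) ℓ)
    (Pi.single (0 : Fin 4) ((reg.boxHalfSide k ℓ : ℕ) : ℤ))

/-- `boxMixing` is the mixing coefficient of the torus functional between two copies of the slab
class at the half-box time shift (definitional unfolding, for rewriting). [folklore] -/
theorem boxMixing_eq_mixingCoeff (reg : QCDRegularisation Nf) (m : Fin Nf → ℝ) (k : ℕ) (ℓ : ℝ) :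
    boxMixing reg m k ℓ = mixingCoeff
      (qcdTorusExpect (reg.β k) (2 * reg.boxHalfSide k ℓ + 1)
        (fun fl => (reg.scheme m 0 0).mq fl k))
      (slabClass (reg.a k) ℓ) (slabClass (reg.a k) ℓ)
      (Pi.single (0 : Fin 4) ((reg.boxHalfSide k ℓ : ℕ) : ℤ)) :=
  rfl

/-- Unfolding the box half-side. [folklore] -/
theorem QCDRegularisation.boxHalfSide_eq (reg : QCDRegularisation Nf) (k : ℕ) (ℓ : ℝ) :
    reg.boxHalfSide k ℓ = ⌊ℓ / (2 * reg.a k)⌋₊ :=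
  rfl

/-- `boxMixing ≤ ε` (real `ε ≥ 0`) unfolded to the slab covariances. [folklore] -/
theorem boxMixing_le_ofReal_iff (reg : QCDRegularisation Nf) (m : Fin Nf → ℝ) (k : ℕ) (ℓ : ℝ)
    {ε : ℝ} (hε : 0 ≤ ε) :
    boxMixing reg m k ℓ ≤ ENNReal.ofReal ε ↔
      ∀ A ∈ (slabClass (reg.a k) ℓ : Set (YMSpecies 𝔾)),
        ∀ B ∈ (slabClass (reg.a k) ℓ : Set (YMSpecies 𝔾)),
        ‖gluonicCov (qcdTorusExpect (reg.β k) (2 * reg.boxHalfSide k ℓ + 1)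
            (fun fl => (reg.scheme m 0 0).mq fl k)) A B
          (Pi.single (0 : Fin 4) ((reg.boxHalfSide k ℓ : ℕ) : ℤ))‖ ≤ ε :=
  mixingCoeff_le_ofReal_iff _ hε

/-- **Bridge to the route's inlined clause.** For `ε ≥ 0`, the slab-covariance clause of
`BoxMixingDecay` / `PhysicalFiniteSizeCriterion` in route `FemtoStepScaling` — written there with the
'let-via-∀' abbreviations `∀ S, S = ⌊ℓ/(2a_k)⌋₊ → ∀ Ex, Ex = qcdTorusExpect … → ∀ ι, ι = … →
∀ InSlab, InSlab = … → ∀ A B, InSlab A → InSlab B → ‖…‖ ≤ ε` — is literally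
`boxMixing reg m k ℓ ≤ ε`. [folklore] -/
theorem forall_slab_le_iff_boxMixing_le (reg : QCDRegularisation Nf) (m : Fin Nf → ℝ) (k : ℕ)
    (ℓ : ℝ) {ε : ℝ} (hε : 0 ≤ ε) :
    (∀ S : ℕ, S = ⌊ℓ / (2 * reg.a k)⌋₊ →
      ∀ Ex : (GaugeConfig 4 (2 * S + 1) 𝔾 → FermiAlg Nf (2 * S + 1)) → ℂ,
        Ex = qcdTorusExpect (reg.β k) (2 * S + 1) (fun fl => (reg.scheme m 0 0).mq fl k) →
      ∀ ι : ℝ → FermiAlg Nf (2 * S + 1), ι = (fun r : ℝ => algebraMap ℂ _ (r : ℂ)) →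
      ∀ InSlab : YMSpecies 𝔾 → Prop,
        InSlab = (fun A => (∀ U, |A.F U| ≤ 1) ∧
          (∀ e ∈ A.supp, (0 : ℤ) ≤ e.1 0 ∧ (8 : ℝ) * ((e.1 0 : ℤ) : ℝ) * reg.a k ≤ ℓ)) →
      ∀ A B : YMSpecies 𝔾, InSlab A → InSlab B →
        ‖(Ex (fun U => ι (A.F (torusLift (2 * S + 1) U)) *
              ι (B.F (configShift (-(Pi.single (0 : Fin 4) ((S : ℕ) : ℤ)))
                (torusLift (2 * S + 1) U)))) -
            Ex (fun U => ι (A.F (torusLift (2 * S + 1) U))) *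
              Ex (fun U => ι (B.F (configShift (-(Pi.single (0 : Fin 4) ((S : ℕ) : ℤ)))
                (torusLift (2 * S + 1) U)))))‖ ≤ ε) ↔
    boxMixing reg m k ℓ ≤ ENNReal.ofReal ε := by
  rw [boxMixing_le_ofReal_iff reg m k ℓ hε]
  constructor
  · intro h A hA B hB
    exact h _ rfl _ rfl _ rfl _ rfl A B hA hB
  · rintro h S rfl Ex rfl ι rfl InSlab rfl A B hA hB
    exact h A hA B hB

/-- **Continuum box-mixing profile `ε(ℓ)`** (request D3 (2)): `limsup_{k → ∞} boxMixing reg m k ℓ`,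
in `ℝ≥0∞` (the lattice step-scaling data `Σ(·, a/L)` extrapolated `a → 0` at fixed physical size, as
an upper limit so that no convergence is presupposed; Weisz (2.155), Del Debbio–Ramos §6.7.2). [folklore] -/
def boxMixingProfile (reg : QCDRegularisation Nf) (m : Fin Nf → ℝ) (ℓ : ℝ) : ℝ≥0∞ :=
  limsup (fun k => boxMixing reg m k ℓ) atTop

/-- If the profile at scale `ℓ` is `< ε` then eventually in the cutoff the box mixing is `< ε`.
[folklore] -/
theorem eventually_boxMixing_lt {reg : QCDRegularisation Nf} {m : Fin Nf → ℝ} {ℓ : ℝ} {ε : ℝ≥0∞}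
    (h : boxMixingProfile reg m ℓ < ε) : ∀ᶠ k in atTop, boxMixing reg m k ℓ < ε :=
  Filter.eventually_lt_of_limsup_lt h

/-- If eventually in the cutoff the box mixing is `≤ ε` then the profile is `≤ ε`. [folklore] -/
theorem boxMixingProfile_le_of_eventually_le {reg : QCDRegularisation Nf} {m : Fin Nf → ℝ} {ℓ : ℝ}
    {ε : ℝ≥0∞} (h : ∀ᶠ k in atTop, boxMixing reg m k ℓ ≤ ε) : boxMixingProfile reg m ℓ ≤ ε :=
  Filter.limsup_le_of_le (by isBoundedDefault) h

end QCD

/-! ### The step variable `z = −(8/3) log(ε/2)` -/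

section StepVariable

/-- **The mixing-to-`z` transform** `z(ε) := log((2/ε)^{8/3}) = −(8/3) log(ε/2)`, from `ℝ≥0∞` to
`EReal`, inverting the transfer-matrix proxy `ε = 2 e^{−3z/8}` of the box mixing in terms of the
finite-volume gap variable `z = m(ℓ) ℓ` (Koller–van Baal's `z = M L`; Lüscher–Weisz–Wolff's running
coupling is a function of it). `z(0) = ⊤`, `z(2) = 0`, `z(⊤) = ⊥`, strictly decreasing and continuous. [cite: KollerVanbaal1986, abstract and eq. (29) (z = M(0⁺)L, the universal expansion parameter)] -/
def zOfMixing (ε : ℝ≥0∞) : EReal :=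
  ENNReal.log ((2 / ε) ^ (8 / 3 : ℝ))

/-- `z = ⊤` exactly when the mixing vanishes. [folklore] -/
@[simp] theorem zOfMixing_eq_top_iff {ε : ℝ≥0∞} : zOfMixing ε = ⊤ ↔ ε = 0 := by
  rw [zOfMixing, ENNReal.log_eq_top_iff, ENNReal.rpow_eq_top_iff_of_pos (by norm_num),
    ENNReal.div_eq_top]
  simp

/-- `z = ⊥` exactly when the mixing is infinite. [folklore] -/
@[simp] theorem zOfMixing_eq_bot_iff {ε : ℝ≥0∞} : zOfMixing ε = ⊥ ↔ ε = ⊤ := by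
  rw [zOfMixing, ENNReal.log_eq_bot_iff, ENNReal.rpow_eq_zero_iff_of_pos (by norm_num),
    ENNReal.div_eq_zero_iff]
  simp

/-- `z(0) = ⊤`. [folklore] -/
@[simp] theorem zOfMixing_zero : zOfMixing 0 = ⊤ := zOfMixing_eq_top_iff.2 rfl

/-- `z(⊤) = ⊥`. [folklore] -/
@[simp] theorem zOfMixing_top : zOfMixing ⊤ = ⊥ := zOfMixing_eq_bot_iff.2 rfl

/-- `z(2) = 0` (`ε = 2` is the trivial bound for `sup ≤ 1` observables). [folklore] -/
@[simp] theorem zOfMixing_two : zOfMixing 2 = 0 := by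
  simp [zOfMixing, ENNReal.div_self]

/-- On `0 < ε < ∞` the transform is the printed formula `z = −(8/3) log(ε/2)`. [folklore] -/
theorem zOfMixing_ofReal {ε : ℝ} (hε : 0 < ε) :
    zOfMixing (ENNReal.ofReal ε) = ((-(8 / 3) * Real.log (ε / 2) : ℝ) : EReal) := by
  have h2 : (2 : ℝ≥0∞) = ENNReal.ofReal 2 := by simp
  rw [zOfMixing, ENNReal.log_rpow, h2, ← ENNReal.ofReal_div_of_pos hε,
    ENNReal.log_ofReal_of_pos (by positivity), ← EReal.coe_mul]
  congr 1
  rw [show (2 : ℝ) / ε = (ε / 2)⁻¹ from (inv_div ε 2).symm, Real.log_inv]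
  ring

/-- Inversion: `z(2 e^{−3t/8}) = t` for every real `t` (so every real value is attained, and
`ε = 2e^{−3z/8}` on finite values). [folklore] -/
theorem zOfMixing_two_mul_exp (t : ℝ) :
    zOfMixing (ENNReal.ofReal (2 * Real.exp (-(3 / 8 * t)))) = (t : EReal) := by
  rw [zOfMixing_ofReal (by positivity)]
  congr 1
  rw [mul_div_cancel_left₀ _ (by norm_num : (2 : ℝ) ≠ 0), Real.log_exp]
  ring

/-- `z` is strictly decreasing in the mixing. [folklore] -/
theorem zOfMixing_strictAnti : StrictAnti zOfMixing := by
  intro ε ε' h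
  refine ENNReal.log_strictMono (ENNReal.rpow_lt_rpow ?_ (by norm_num))
  rw [div_eq_mul_inv, div_eq_mul_inv]
  exact ENNReal.mul_lt_mul_right two_ne_zero ENNReal.ofNat_ne_top (ENNReal.inv_lt_inv.2 h)

/-- `z < z'` iff the mixings compare the other way. [folklore] -/
theorem zOfMixing_lt_zOfMixing_iff {ε ε' : ℝ≥0∞} : zOfMixing ε < zOfMixing ε' ↔ ε' < ε :=
  zOfMixing_strictAnti.lt_iff_gt

/-- `z` is continuous. [folklore] -/
theorem continuous_zOfMixing : Continuous zOfMixing := by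
  have h : Continuous fun ε : ℝ≥0∞ => 2 / ε := by
    simp_rw [div_eq_mul_inv]
    exact (ENNReal.continuous_const_mul ENNReal.ofNat_ne_top).comp continuous_inv
  exact ENNReal.continuous_log.comp (ENNReal.continuous_rpow_const.comp h)

/-- **`z → ∞ ⟺ ε → 0`** along any filter: for a family of mixings `f`, `zOfMixing ∘ f → ⊤` iff
`f → 0`. [folklore] -/
theorem tendsto_zOfMixing_comp_nhds_top_iff {α : Type*} {F : Filter α} {f : α → ℝ≥0∞} :
    Tendsto (fun i => zOfMixing (f i)) F (𝓝 ⊤) ↔ Tendsto f F (𝓝 0) := by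
  constructor
  · intro h
    rw [ENNReal.tendsto_nhds_zero]
    intro ε hε
    by_cases hεt : ε = ⊤
    · exact Eventually.of_forall fun i => hεt ▸ le_top
    have hzt : zOfMixing ε ≠ ⊤ := by simpa using hε.ne'
    have hzb : zOfMixing ε ≠ ⊥ := by simpa using hεt
    have hx : ((zOfMixing ε).toReal : EReal) = zOfMixing ε := EReal.coe_toReal hzt hzb
    filter_upwards [(EReal.tendsto_nhds_top_iff_real.1 h) (zOfMixing ε).toReal] with i hi
    rw [hx, zOfMixing_lt_zOfMixing_iff] at hi
    exact hi.le
  · intro h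
    have h0 : Tendsto zOfMixing (𝓝 0) (𝓝 ⊤) := by
      simpa only [zOfMixing_zero] using continuous_zOfMixing.tendsto 0
    exact h0.comp h

end StepVariable

/-! ### The step variable of lattice QCD and the step relation `σ` -/

section StepRelation

variable {Nf : ℕ}

/-- **The step variable `z(ℓ)` of lattice QCD at physical scale `ℓ`** (request D3 (3)):
`z(ℓ) := −(8/3) log(ε(ℓ)/2)`, `ε(ℓ)` the continuum box-mixing profile — the Lüscher–Weisz–Wolff-type
one-real-variable carrier of the infrared problem ("finite volume is the scheme"), in `EReal`
(`⊤` iff `ε(ℓ) = 0`). [cite: LuscherWeiszWolff1991, §1–2 (finite-volume running coupling from the mass gap)] -/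
def boxMixingZ (reg : QCDRegularisation Nf) (m : Fin Nf → ℝ) (ℓ : ℝ) : EReal :=
  zOfMixing (boxMixingProfile reg m ℓ)

/-- `z(ℓ) = ⊤` iff the continuum box-mixing profile vanishes at `ℓ`. [folklore] -/
theorem boxMixingZ_eq_top_iff {reg : QCDRegularisation Nf} {m : Fin Nf → ℝ} {ℓ : ℝ} :
    boxMixingZ reg m ℓ = ⊤ ↔ boxMixingProfile reg m ℓ = 0 :=
  zOfMixing_eq_top_iff

/-- **`z(ℓ_i) → ∞ ⟺ ε(ℓ_i) → 0`** along any family of scales `u` and filter `F` (e.g. `u n = 2ⁿ ℓ₀`,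
`F = atTop`: the ladder climbs past every threshold iff the box mixing dies). [folklore] -/
theorem tendsto_boxMixingZ_nhds_top_iff {reg : QCDRegularisation Nf} {m : Fin Nf → ℝ} {α : Type*}
    {F : Filter α} {u : α → ℝ} :
    Tendsto (fun i => boxMixingZ reg m (u i)) F (𝓝 ⊤) ↔
      Tendsto (fun i => boxMixingProfile reg m (u i)) F (𝓝 0) :=
  tendsto_zOfMixing_comp_nhds_top_iff

/-- **The step relation `σ ⊆ ℝ × ℝ`** (request D3 (3)): the closure of the finite pairs
`(z(ℓ), z(2ℓ))`, `ℓ > 0` — the set-valued step-scaling function of the one real variable `z`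
(relating the variable at one volume to that at double the volume, as the continuum step scaling
function `σ(ḡ²(L)) = ḡ²(2L)` does for a finite-volume coupling; a genuine function where the
limits are unique). [cite: Weisz2010, §2.3.2 (2.154)–(2.157)] [cite: DebbioRamos2021, §6.7.2] -/
def stepRelation (reg : QCDRegularisation Nf) (m : Fin Nf → ℝ) : Set (ℝ × ℝ) :=
  closure {p : ℝ × ℝ | ∃ ℓ : ℝ, 0 < ℓ ∧ boxMixingZ reg m ℓ = (p.1 : EReal) ∧
    boxMixingZ reg m (2 * ℓ) = (p.2 : EReal)}

/-- The step relation is closed. [folklore] -/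
theorem isClosed_stepRelation (reg : QCDRegularisation Nf) (m : Fin Nf → ℝ) :
    IsClosed (stepRelation reg m) :=
  isClosed_closure

/-- Finite pairs `(z(ℓ), z(2ℓ))` lie on the step relation. [folklore] -/
theorem mem_stepRelation {reg : QCDRegularisation Nf} {m : Fin Nf → ℝ} {ℓ x y : ℝ} (hℓ : 0 < ℓ)
    (hx : boxMixingZ reg m ℓ = (x : EReal)) (hy : boxMixingZ reg m (2 * ℓ) = (y : EReal)) :
    (x, y) ∈ stepRelation reg m :=
  subset_closure ⟨ℓ, hℓ, hx, hy⟩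

end StepRelation

end Literature.MathematicalPhysics.QuantumFieldTheory

end
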